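import Summits.Schanuel.Schanuel.Theorems.DiophantineDichotomyKhovanskiiApproxTypeEvDefs
import Summits.Schanuel.Schanuel.Theorems.DiophantineDichotomyApproximationRaceEv
import Summits.Schanuel.Schanuel.Theorems.DiophantineDichotomyKhovanskiiReduction
import Summits.Schanuel.Schanuel.Theorems.DiophantineDichotomyTypedImpliesEv
import HarnessLib

/-!
# Route `DiophantineDichotomy`, crux `KhovanskiiApproxTypeEv` (stmt-Schanuel-14972):
# the MINIMAL race input (liminf / single-level form) — sufficiency, and what it still contains

Restatement input R4 of the crux chain (ideator round 2 / k5,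
`Cruxes/KhovanskiiApproxTypeEv/IdeatorR2K5Notes.md` §4, checked there as `SketchIdeatorR2K5.lean`;
landed by line lead a3).  Vocabulary (`IsLevel`, `RaceInputAt`, `KhovanskiiRaceInput`,
`ApproximationRaceLiminf`) is in `Theorems/DiophantineDichotomyKhovanskiiApproxTypeEvDefs.lean`,
namespace `…KhovanskiiApproxTypeEv.RaceInput`.

`RaceInputAt n s`: for every `ε > 0` there are infinitely many degree levels `D` at which,
eventually in the height `H`, every algebraic challenger `γ` of level `(D, H)` stays at distance
`≥ exp(−(ε·D^{1/(n−1)}·log H + κ))` from `θ = (s, e^s)`.  No exponent `a`, no constant `C`, no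
`dᵇ` term, no "for all `d`": the prover CHOOSES the favourable degrees.

## Contents (all implications; nothing is credited to the summit)

* `race_at_one_level` — THE ENGINE (race compactness at ONE degree level): an approximation
  property of level `t` with constant `c` at a point `θ ∈ ℂ^ι` having a transcendental coordinate
  is incompatible with a measure of exponent `D^{1/t}/(2c²)` at any single level `D ≥ (c²)ᵗ`,
  eventually in the height (put `Δ := D^{1/t}/c ≥ c`, so that the degree cap `(cΔ)ᵗ` IS `D`; the
  points all of whose coordinates are roots of non-zero integer polynomials of degree `≤ D` and
  height `≤ H₀` form a finite set missing `θ`, so for `Y → ∞` the approximant at `(Δ, Y)` has height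
  `> H₀`; then `D^{1/t} log H/(2c²) + dY/c ≤ κ` is absurd for `Y > cκ`).
* `raceInputAt_of_approxTypeEvAt`, `khovanskiiRaceInput_of_ev`, `khovanskiiRaceInput_of_typed` —
  the crux as filed (a fortiori the all-heights support `KhovanskiiApproxType`) implies the minimal
  input: choose the level `D` with `C·Dᵃ ≤ ε·D^{1/(n−1)}`, `κ := C·Dᵇ`.
* `approximationRaceLiminf : ApproximationProperty → KhovanskiiRaceInput → KhovanskiiSchanuel` and
  `schanuel_of_raceInput : ApproximationProperty → KhovanskiiRaceInput → Schanuel` (with the landed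
  `khovanskiiReduction_proof`) — the minimal input is RACE-SUFFICIENT: a route restated on it keeps a
  certified deciding theorem.
* HONESTY CAVEAT (R2 for R4) — in the companion file
  `Theorems/DiophantineDichotomyKhovanskiiApproxTypeEvRaceLiminfHardness.lean`: the minimal input
  alone forces `2 ≤ trdeg_ℚ ℚ(s, e^s)` at every point (`two_le_trdeg_of_raceInputAt`, the engine
  with the PROVED level-one property), hence `KhovanskiiRaceInput → e ⊥ π ∧ πi ⊥ log 2 ∧
  log 2 ⊥ log 3` (`barriers_of_khovanskiiRaceInput`): the restatement does not leave the
  catalogued barriers; it is only the honest MINIMUM of what the route asserts beyond Schanuel.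
-/

noncomputable section

-- `Summit.Schanuel.Schanuel.…` is the mandated summit/sub-problem namespace (single-conjunct summit), hence:
set_option linter.dupNamespace false

namespace Summit.Schanuel.Schanuel.Cruxes.KhovanskiiApproxTypeEv.RaceInput

open Summit.Schanuel.Schanuel.Theses.DiophantineDichotomy
  (KhovanskiiApproxTypeEv KhovanskiiApproxType ApproximationProperty KhovanskiiSchanuel)
open Summit.Schanuel.Schanuel.Cruxes.KhovanskiiApproxType.LwSmallHeight (IsFreeKhovanskii)
open Summit.Schanuel.Schanuel.Cruxes.KhovanskiiApproxTypeEv.AnchoredReduction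
  (ApproxTypeEvAt khovanskiiApproxTypeEv_iff)
open Summit.Schanuel.Schanuel.Theorems
  (khovanskiiReduction_proof typedImpliesEv_proof ApproximationRace.one_le_of_root
    ApproximationRace.one_le_trdeg_of_mem ApproximationRaceEv.finite_roots
    ApproximationRaceEv.isAlgebraic_of_root)

/-! ## Bookkeeping on levels -/

/-- Level `(d, H)` is contained in level `(D, H')` for `d ≤ D`, `H ≤ H'`. [folklore] -/
theorem isLevel_mono {n d D H H' : ℕ} {γ : Fin n ⊕ Fin n → ℂ} (hdD : d ≤ D) (hHH' : H ≤ H')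
    (h : IsLevel n d H γ) : IsLevel n D H' γ := by
  refine ⟨h.1.trans hdD, fun i => ?_⟩
  obtain ⟨P, hP0, hPdeg, hPH, hPz⟩ := h.2 i
  exact ⟨P, hP0, hPdeg.trans hdD, fun k => (hPH k).trans (by exact_mod_cast hHH'), hPz⟩

/-- At `θ = (s, e^s)` with `s` `ℚ`-linearly independent and `n ≥ 1` some coordinate of `θ` is
transcendental: `s 0 ≠ 0`, so `s 0` or `e^{s 0}` is (Hermite–Lindemann, PROVED in tree). [folklore] -/
theorem exists_transcendental_coord {n : ℕ} {s : Fin n → ℂ} (hn : 1 ≤ n)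
    (hs : LinearIndependent ℚ s) : ∃ i, Transcendental ℚ (Sum.elim s (Complex.exp ∘ s) i) := by
  have hs0 : s ⟨0, by omega⟩ ≠ 0 := hs.ne_zero ⟨0, by omega⟩
  by_cases halg : IsAlgebraic ℚ (s ⟨0, by omega⟩)
  · exact ⟨Sum.inr ⟨0, by omega⟩,
      Literature.NumberTheory.Transcendental.transcendental_exp_holds halg hs0⟩
  · exact ⟨Sum.inl ⟨0, by omega⟩, halg⟩

/-! ## The engine: race compactness at ONE degree level -/

/-- **Race at one level.**  Let `θ ∈ ℂ^ι` have a transcendental coordinate, and suppose an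
approximation property of level `t ≥ 1` with constant `c ≥ 1` holds at `θ`: for all `Y ≥ Δ ≥ c`
there is a challenger `γ` with `[ℚ(γ):ℚ] ≤ d ≤ (cΔ)ᵗ`, coordinates roots of non-zero integer
polynomials of degree `≤ d` and height `≤ H`, and `‖γ − θ‖ ≤ exp(−(Δ log H + dY)/c)`.  Then NO
single degree level `D ≥ (c²)ᵗ` carries, eventually in the height, the measure
`‖γ − θ‖ ≥ exp(−(D^{1/t} log H/(2c²) + κ))` for the challengers of level `(D, H)`.
Proof: `Δ := D^{1/t}/c ≥ c` makes the cap `(cΔ)ᵗ` equal to `D`; naive Northcott finiteness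
(`ApproximationRaceEv.finite_roots`) of the points of level `(D, H₀)` and `θ ∉` that finite set push
the approximant's height past `H₀` once `Y` is large; the two exponential bounds then give
`D^{1/t} log H/c² + dY/c ≤ D^{1/t} log H/(2c²) + κ`, absurd for `Y > cκ`. [folklore] -/
theorem race_at_one_level {ι : Type} [Fintype ι] {θ : ι → ℂ} (hθ : ∃ i, Transcendental ℚ (θ i))
    {c : ℝ} (hc1 : 1 ≤ c) {t : ℕ} (ht1 : 1 ≤ t)
    (hAP : ∀ Δ Y : ℝ, c ≤ Δ → Δ ≤ Y → ∃ (γ : ι → ℂ) (d H : ℕ),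
      Module.finrank ℚ ↥(IntermediateField.adjoin ℚ (Set.range γ)) ≤ d ∧
      (∀ i, ∃ P : Polynomial ℤ, P ≠ 0 ∧ P.natDegree ≤ d ∧ (∀ k, |P.coeff k| ≤ (H : ℤ)) ∧
        Polynomial.aeval (γ i) P = 0) ∧
      (d : ℝ) ≤ (c * Δ) ^ t ∧ ‖γ - θ‖ ≤ Real.exp (-((Real.log H * Δ + d * Y) / c)))
    {D : ℕ} (hDge : (c ^ 2) ^ t ≤ (D : ℝ)) {κ : ℝ} {Hm : ℕ}
    (hmeas : ∀ (H : ℕ) (γ : ι → ℂ), Hm ≤ H →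
      Module.finrank ℚ ↥(IntermediateField.adjoin ℚ (Set.range γ)) ≤ D →
      (∀ i, ∃ P : Polynomial ℤ, P ≠ 0 ∧ P.natDegree ≤ D ∧ (∀ k, |P.coeff k| ≤ (H : ℤ)) ∧
        Polynomial.aeval (γ i) P = 0) →
      Real.exp (-(1 / (2 * c ^ 2) * (D : ℝ) ^ (1 / (t : ℝ)) * Real.log H + κ)) ≤ ‖γ - θ‖) :
    False := by
  obtain ⟨i₀, hi₀⟩ := hθ
  have hcpos : (0 : ℝ) < c := lt_of_lt_of_le one_pos hc1
  have htpos : (0 : ℝ) < t := by exact_mod_cast ht1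
  have hDpos : (0 : ℝ) < D := lt_of_lt_of_le (by positivity) hDge
  -- `Pw := D^{1/t}` and `Δ := Pw / c`
  set Pw : ℝ := (D : ℝ) ^ (1 / (t : ℝ)) with hPw
  have hPwpos : 0 < Pw := Real.rpow_pos_of_pos hDpos _
  have hPwpow : Pw ^ t = (D : ℝ) := by
    rw [hPw, ← Real.rpow_natCast, ← Real.rpow_mul hDpos.le, one_div_mul_cancel htpos.ne',
      Real.rpow_one]
  have hPwge : c ^ 2 ≤ Pw := by
    have h0 : (0 : ℝ) ≤ (c ^ 2) ^ t := by positivity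
    have h1 : ((c ^ 2) ^ t : ℝ) ^ (1 / (t : ℝ)) ≤ Pw := Real.rpow_le_rpow h0 hDge (by positivity)
    have h2 : ((c ^ 2) ^ t : ℝ) ^ (1 / (t : ℝ)) = c ^ 2 := by
      rw [← Real.rpow_natCast, ← Real.rpow_mul (by positivity), mul_one_div_cancel htpos.ne',
        Real.rpow_one]
    rw [h2] at h1
    exact h1
  have hcΔ : c ≤ Pw / c := by
    rw [le_div_iff₀ hcpos]
    nlinarith [hPwge]
  have hΔpos : 0 < Pw / c := lt_of_lt_of_le hcpos hcΔ
  have hcΔ' : c * (Pw / c) = Pw := by field_simp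
  -- the finite set `E` of points of level `(D, Hm)` (coordinatewise), which misses `θ`
  set E : Set (ι → ℂ) := {γ | ∀ i, ∃ P : Polynomial ℤ, P ≠ 0 ∧ P.natDegree ≤ D ∧
    (∀ k, |P.coeff k| ≤ (Hm : ℤ)) ∧ Polynomial.aeval (γ i) P = 0} with hE
  have hEfin : E.Finite := by
    refine (Set.Finite.pi fun (_ : ι) => ApproximationRaceEv.finite_roots D Hm).subset fun γ hγ => ?_
    rw [Set.mem_univ_pi]
    exact hγ
  have hθE : θ ∉ E := by
    intro hθ
    obtain ⟨P, hP0, -, -, hPz⟩ := hθ i₀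
    exact hi₀ (ApproximationRaceEv.isAlgebraic_of_root hP0 hPz)
  have htend : Filter.Tendsto (fun Y : ℝ => Real.exp (-(Y / c))) Filter.atTop (nhds 0) :=
    Real.tendsto_exp_atBot.comp
      (Filter.tendsto_neg_atTop_atBot.comp (Filter.tendsto_id.atTop_div_const hcpos))
  have hall : ∀ᶠ Y : ℝ in Filter.atTop, ∀ p ∈ E, Real.exp (-(Y / c)) < ‖p - θ‖ := by
    refine (hEfin.eventually_all).mpr fun p hp => htend.eventually (gt_mem_nhds ?_)
    rw [norm_pos_iff, sub_ne_zero]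
    rintro rfl
    exact hθE hp
  obtain ⟨Y, hΔY, hY1, hY0, hYsep⟩ :=
    ((Filter.eventually_ge_atTop (Pw / c)).and ((Filter.eventually_ge_atTop (κ * c + 1)).and
      ((Filter.eventually_ge_atTop (0 : ℝ)).and hall))).exists
  -- the approximant at scale `(Δ, Y)`
  obtain ⟨γ, d, H, hfin, hpoly, hdcap, hdist⟩ := hAP (Pw / c) Y hcΔ hΔY
  obtain ⟨P₀, hP₀0, hP₀deg, -, hP₀z⟩ := hpoly i₀
  have h1d : 1 ≤ d := ApproximationRace.one_le_of_root hP₀0 hP₀deg hP₀z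
  -- the degree cap `(cΔ)ᵗ = D`
  have hdD : d ≤ D := by
    have h1 : (d : ℝ) ≤ (D : ℝ) := by rw [hcΔ', hPwpow] at hdcap; exact hdcap
    exact_mod_cast h1
  have hdistY : ‖γ - θ‖ ≤ Real.exp (-(Y / c)) := by
    refine hdist.trans (Real.exp_le_exp.mpr ?_)
    have hlogH : 0 ≤ Real.log H := Real.log_natCast_nonneg H
    have hYle : Y ≤ Real.log H * (Pw / c) + d * Y := by
      have hdY : Y ≤ (d : ℝ) * Y := le_mul_of_one_le_left hY0 (by exact_mod_cast h1d)
      nlinarith [mul_nonneg hlogH hΔpos.le]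
    have := div_le_div_of_nonneg_right hYle hcpos.le
    linarith
  have hγE : γ ∉ E := fun hγ => absurd hdistY (not_le.mpr (hYsep γ hγ))
  -- hence the height is past the threshold `Hm`
  have hHm_lt : Hm < H := by
    by_contra hH
    push Not at hH
    refine hγE fun i => ?_
    obtain ⟨P, hP0, hPdeg, hPH, hPz⟩ := hpoly i
    exact ⟨P, hP0, hPdeg.trans hdD, fun k => (hPH k).trans (by exact_mod_cast hH), hPz⟩
  -- the measure at level `(D, H)` applies to `γ`
  have hlow := hmeas H γ hHm_lt.le (hfin.trans hdD) fun i => by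
    obtain ⟨P, hP0, hPdeg, hPH, hPz⟩ := hpoly i
    exact ⟨P, hP0, hPdeg.trans hdD, hPH, hPz⟩
  have hsand := neg_le_neg (Real.exp_le_exp.mp (hlow.trans hdist))
  rw [neg_neg, neg_neg] at hsand
  -- `hsand : (log H · Δ + d Y)/c ≤ Pw · log H/(2c²) + κ`; now the arithmetic
  set L : ℝ := Real.log H with hL
  have hL0 : 0 ≤ L := Real.log_natCast_nonneg H
  set Q : ℝ := L * Pw with hQ
  have hQ0 : 0 ≤ Q := mul_nonneg hL0 hPwpos.le
  have e1 : (L * (Pw / c) + d * Y) / c = Q / c ^ 2 + d * Y / c := by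
    rw [hQ]; field_simp
  have e2 : 1 / (2 * c ^ 2) * Pw * L + κ = Q / c ^ 2 / 2 + κ := by
    rw [hQ]; field_simp
  rw [e1, e2] at hsand
  have hQc : 0 ≤ Q / c ^ 2 := div_nonneg hQ0 (by positivity)
  have hdY : Y / c ≤ d * Y / c :=
    div_le_div_of_nonneg_right (le_mul_of_one_le_left hY0 (by exact_mod_cast h1d)) hcpos.le
  have hYc : κ + 1 / c ≤ Y / c := by
    rw [le_div_iff₀ hcpos]
    have e3 : (κ + 1 / c) * c = κ * c + 1 := by field_simp
    linarith [e3, hY1]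
  have hcinv : (0 : ℝ) < 1 / c := by positivity
  linarith [hQc, hdY, hYc, hcinv, hsand]

/-! ## The crux as filed implies the minimal input -/

/-- An eventual type with exponent `a < 1/(n−1)` gives the minimal race input: choose the level
`D` with `C · Dᵃ ≤ ε · D^{1/(n−1)}` (possible since `D^{1/(n−1) − a} → ∞`), `κ := C · Dᵇ`, and keep
the threshold `H₀(D)`. [folklore] -/
theorem raceInputAt_of_approxTypeEvAt {n : ℕ} {s : Fin n → ℂ} {a b C : ℝ}
    (ha : a < 1 / ((n : ℝ) - 1)) (h : ApproxTypeEvAt n s a b C) : RaceInputAt n s := by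
  obtain ⟨hC, hmeas⟩ := h
  intro ε hε D₀
  set e : ℝ := 1 / ((n : ℝ) - 1) with he
  have hea : 0 < e - a := sub_pos.mpr ha
  -- eventually in `x : ℝ`, `C / ε ≤ x ^ (e - a)`
  have hev : ∀ᶠ x : ℝ in Filter.atTop, C / ε ≤ x ^ (e - a) :=
    (tendsto_rpow_atTop hea).eventually_ge_atTop (C / ε)
  have hevN : ∀ᶠ D : ℕ in Filter.atTop, C / ε ≤ (D : ℝ) ^ (e - a) :=
    tendsto_natCast_atTop_atTop.eventually hev
  obtain ⟨D, hD, hD₀, hD1⟩ :=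
    (hevN.and ((Filter.eventually_ge_atTop D₀).and (Filter.eventually_ge_atTop 1))).exists
  obtain ⟨H₀, hH₀⟩ := hmeas D
  refine ⟨D, hD₀, C * (D : ℝ) ^ b, H₀, fun H γ hH hγ => ?_⟩
  have hlow := hH₀ H γ hH hγ.1 hγ.2
  refine le_trans (Real.exp_le_exp.mpr ?_) hlow
  -- compare the exponents: `C (Dᵃ log H + Dᵇ) ≤ ε D^e log H + C Dᵇ`
  have hDpos : (0 : ℝ) < D := by exact_mod_cast hD1
  have hlog : 0 ≤ Real.log H := Real.log_natCast_nonneg H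
  have hkey : C * (D : ℝ) ^ a ≤ ε * (D : ℝ) ^ e := by
    have h1 : C ≤ ε * (D : ℝ) ^ (e - a) := by
      have := (div_le_iff₀ hε).mp hD
      linarith [this]
    have h2 : C * (D : ℝ) ^ a ≤ ε * (D : ℝ) ^ (e - a) * (D : ℝ) ^ a :=
      mul_le_mul_of_nonneg_right h1 (Real.rpow_nonneg hDpos.le a)
    calc C * (D : ℝ) ^ a ≤ ε * (D : ℝ) ^ (e - a) * (D : ℝ) ^ a := h2
      _ = ε * ((D : ℝ) ^ (e - a) * (D : ℝ) ^ a) := by ring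
      _ = ε * (D : ℝ) ^ e := by rw [← Real.rpow_add hDpos, sub_add_cancel]
  have h3 : C * (D : ℝ) ^ a * Real.log H ≤ ε * (D : ℝ) ^ e * Real.log H :=
    mul_le_mul_of_nonneg_right hkey hlog
  have h4 : C * ((D : ℝ) ^ a * Real.log H + (D : ℝ) ^ b) =
      C * (D : ℝ) ^ a * Real.log H + C * (D : ℝ) ^ b := by ring
  rw [neg_le_neg_iff, h4]
  linarith

/-- **The crux as filed implies the liminf-form restatement**:
`KhovanskiiApproxTypeEv → KhovanskiiRaceInput`. [folklore] -/
theorem khovanskiiRaceInput_of_ev (hEv : KhovanskiiApproxTypeEv) : KhovanskiiRaceInput := by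
  intro n s hn hs hfree
  obtain ⟨a, b, C, ha, hT⟩ := (khovanskiiApproxTypeEv_iff.mp hEv) n s hn hs hfree
  exact raceInputAt_of_approxTypeEvAt ha hT

/-- The all-heights support `KhovanskiiApproxType` (stmt-Schanuel-6116) implies the liminf-form
restatement too (through the landed `typedImpliesEv_proof`). [folklore] -/
theorem khovanskiiRaceInput_of_typed (hT : KhovanskiiApproxType) : KhovanskiiRaceInput :=
  khovanskiiRaceInput_of_ev (typedImpliesEv_proof hT)

/-! ## The minimal input is race-sufficient -/

/-- **The race from the minimal input (R4, certified).**  Philippon's approximation property and the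
liminf-form input at every free Khovanskii point give Schanuel at free Khovanskii points.  If
`trdeg ℚ(θ) ≤ t = n − 1`, let `c` be the approximation-property constant at `θ`, take
`ε := 1/(2c²)` and a level `D ≥ (c²)ᵗ` supplied by `RaceInputAt`; `race_at_one_level` finishes.
(`n = 0` is empty; `n = 1` is Hermite–Lindemann.) [folklore] -/
theorem approximationRaceLiminf : ApproximationRaceLiminf := by
  intro hAP hRI n s hs hg
  rcases Nat.lt_or_ge n 2 with hn | hn
  · interval_cases n
    · simp
    · -- `n = 1`: a transcendental coordinate of `θ` (Hermite–Lindemann)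
      rw [Nat.cast_one]
      obtain ⟨i, hi⟩ := exists_transcendental_coord le_rfl hs
      refine ApproximationRace.one_le_trdeg_of_mem (IntermediateField.subset_adjoin ℚ _ ?_) hi
      rw [← Set.Sum.elim_range]
      exact ⟨i, rfl⟩
  · -- `n ≥ 2`: the race at ONE level
    by_contra hlt
    rw [not_le] at hlt
    set t : ℕ := n - 1 with ht
    have htn : n = t + 1 := by omega
    have ht1 : 1 ≤ t := by omega
    have key : ∀ S : Set ℂ, S = Set.range s ∪ Set.range (Complex.exp ∘ s) →
        Algebra.trdeg ℚ ↥(IntermediateField.adjoin ℚ S) ≤ (t : Cardinal) := by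
      rintro S rfl
      have h1 : (n : Cardinal) = Order.succ (t : Cardinal) := by
        rw [Cardinal.succ_natCast]
        exact_mod_cast htn
      rw [h1] at hlt
      exact Order.lt_succ_iff.mp hlt
    obtain ⟨c, hc1, hAP'⟩ := hAP (Fin n ⊕ Fin n) (Sum.elim s (Complex.exp ∘ s)) t
      ht1 (key _ (Set.Sum.elim_range _ _))
    have hcpos : (0 : ℝ) < c := lt_of_lt_of_le one_pos hc1
    -- the minimal input at `θ`: `ε := 1/(2c²)`, a level `D ≥ (c²)ᵗ`
    have hε : (0 : ℝ) < 1 / (2 * c ^ 2) := by positivity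
    obtain ⟨D, hD₀, κ, Hm, hmeas⟩ :=
      hRI n s hn hs hg (1 / (2 * c ^ 2)) hε (⌈(c ^ 2) ^ t⌉₊ + 1)
    have hDge : (c ^ 2) ^ t ≤ (D : ℝ) := by
      have h1 : ((c ^ 2) ^ t : ℝ) ≤ ⌈(c ^ 2) ^ t⌉₊ := Nat.le_ceil _
      have h2 : ((⌈(c ^ 2) ^ t⌉₊ : ℕ) : ℝ) ≤ D := by exact_mod_cast le_trans (Nat.le_succ _) hD₀
      exact h1.trans h2
    have hnt : (n : ℝ) - 1 = (t : ℝ) := by rw [htn]; push_cast; ring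
    refine race_at_one_level (exists_transcendental_coord (by omega) hs) hc1 ht1
      (fun Δ Y hcΔ hΔY => ?_) hDge (κ := κ) (Hm := Hm) fun H γ hH hfin hpoly => ?_
    · obtain ⟨γ, d, H, hfin, hpoly, hdcap, -, hdist⟩ := hAP' Δ Y hcΔ hΔY
      exact ⟨γ, d, H, hfin, hpoly, hdcap, hdist⟩
    · have h := hmeas H γ hH ⟨hfin, hpoly⟩
      rw [hnt] at h
      exact h

/-- **A restated route keeps a certified deciding theorem**: Philippon's approximation property
and the minimal race input give Schanuel's conjecture (`approximationRaceLiminf` and the landed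
reduction `khovanskiiReduction_proof`, d99e6b8a9f30). [folklore] -/
theorem schanuel_of_raceInput (hAP : ApproximationProperty) (hRI : KhovanskiiRaceInput) :
    _root_.Schanuel :=
  khovanskiiReduction_proof (approximationRaceLiminf hAP hRI)

end Summit.Schanuel.Schanuel.Cruxes.KhovanskiiApproxTypeEv.RaceInput

end
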